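import Summits.BirchSwinnertonDyer.BirchSwinnertonDyer.Theorems.AlignedTransportAtTwoMainConjectureOfRankZeroBSDAtTwoCyclotomicLayerRankJumpBound
import HarnessLib

/-!
# Route `AlignedTransportAtTwo`, crux C2 `MainConjectureOfRankZeroBSDAtTwo` (stmt-BirchSwinnertonDyer-22298):
# THE EXACT JUMP — `rank E(K_{n+1}) − rank E(K_n) = pⁿ(p−1)·e_{n+1}` IS A MULTIPLE OF `φ(p^{n+1})` in EVERY `ℤ_p`-tower, and `Φ_{p^{n+1}}(1+T)^{e_{n+1}} ∣ char_Λ X`;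
# over `ℚ` (Kato): `Φ_{p^{n+1}}(1+T)^{e_{n+1}} ∣ L_p(E,T)`

HONEST FRAMING (cell `bsd-f1-sign2`, WIDTH-5 attached prover seat `bsd-line-att-p5` gen 36 on line `birth` of the lead `bsd-line-att-p2`;
`--supports` stmt-BirchSwinnertonDyer-22298, closes nothing; BSD is NOT proved by any of this; the crux C2, its verdict «blocked-on
`Rank1Residual.GreenbergMuConjectureIrreducible`» and every registered stub are untouched). THEOREMS ONLY — no `def`, no named fact, no `sorry`; the one print
binder in §2 is the lineage's `h17 : kato_divisibility_allPrimes W p` (Kato 17.4 (1)(2)). This file supplies the integrality «`e_n = (rank E(ℚ_n) − rank E(ℚ_{n−1}))/(p^{n−1}(p−1))`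
is a non-negative integer» that the tree's `Rank1Residual/FineSelmerGcdProblems.lean` had to ASSUME in its transcription of Kurihara–Pollack's (Gr)/(KP) («representation theory of
`ℤ/pⁿ`, NOT a tree theorem»), as a THEOREM for every `ℤ_p`-tower of every number field, together with the divisibility `Φ_{p^{n+1}}(1+T)^{e_{n+1}} ∣ char_Λ X(E/K_∞)`.

THE POINT. `A_n = ker(N_n) ⊆ E(K_{n+1})` (the kernel lattice of the relative norm) has `rank_ℤ A_n = pⁿ(p−1)·c` (`…RankDichotomy` §1) and feeds `Φ^c ∣ f` (`…RankJumpBound`);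
rank–nullity gives `rank E(K_{n+1}) ≤ rank E(K_n) + rank A_n`. NEW here: the REVERSE inequality — inside `E(K̄)`, `ι_{n+1}(A_n) ∩ ι_n(E(K_n))` is killed by `p` (for `Q ∈ E(K_n)`,
`N_n(Q) = p·Q`), so `rank(ι_{n+1}(A_n) + ι_n(E(K_n))) = rank A_n + rank E(K_n) ≤ rank E(K_{n+1})` (Mathlib `Submodule.rank_sup_add_rank_inf_eq` over the domain `ℤ`).

* ★★★ `exists_cyclotomicLayer_pow_dvd_and_mordellWeilRank_eq` — **`∃ c, Φ_{p^{n+1}}(1+T)^c ∣ f ∧ rank E(K_{n+1}) = rank E(K_n) + pⁿ(p−1)·c`** (any `E/K`, `ℤ_p`-extension, torsion f.g.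
  dual datum, `f ∈ char_Λ X`); ★★ `totient_dvd_mordellWeilRank_layer_succ_sub` — **`pⁿ(p−1) ∣ rank E(K_{n+1}) − rank E(K_n)`**; ★★ `cyclotomicLayer_pow_jump_div_dvd` —
  **`Φ_{p^{n+1}}(1+T)^{(rank E(K_{n+1}) − rank E(K_n))/(pⁿ(p−1))} ∣ f`**.
* §2 over `ℚ` (PRINT `h17`): `exists_cyclotomicLayer_pow_dvd_lift_and_mordellWeilRank_eq`, ★★ `cyclotomicLayer_pow_jump_div_dvd_lift` —
  **`Φ_{p^{n+1}}(1+T)^{e_{n+1}} ∣ G`, `e_{n+1} = (rank W(ℚ_{n+1}) − rank W(ℚ_n))/φ(p^{n+1})`** for every integral lift `G` of `L_p(f,α)`: the order of vanishing of the `p`-adic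
  `L`-function at the characters of order `p^{n+1}` is AT LEAST the Mordell–Weil multiplicity `e_{n+1}` (Kato's «`rank ≤ ord L_p`», layer by layer, exact normalisation).

References: K. Kato, Astérisque 295 (2004), Thm. 17.4, 18.4 [Kato2004Asterisque]; R. Greenberg, LNM 1716 (1999), Thm. 1.9, §5 p. 132 [GreenbergLNM1716];
M. Kurihara, R. Pollack (2007), §0.3 Problem 0.7 and §3.1 («which is a non-negative integer») [KuriharaPollack2007]; L. Washington, GTM 83, §13.1 [Washington1997].
-/

set_option linter.dupNamespace false
set_option autoImplicit false

noncomputable section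

open scoped Classical Polynomial MatrixGroups ModularForm

namespace Summit.BirchSwinnertonDyer.BirchSwinnertonDyer.Theorems.AlignedTransportAtTwoCyclotomicLayerRankJumpExact

open Polynomial WeierstrassCurve Literature.NumberTheory.EllipticCurves
  Summit.BirchSwinnertonDyer.Rank1Residual.X1.MuLambda
  Summit.BirchSwinnertonDyer.Rank1Residual.Iwasawa
  Summit.BirchSwinnertonDyer.BirchSwinnertonDyer.Theorems.AlignedTransportAtTwoCyclotomicLayerNorm
  Summit.BirchSwinnertonDyer.BirchSwinnertonDyer.Theorems.AlignedTransportAtTwoCyclotomicLayerRankGrowth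
  Summit.BirchSwinnertonDyer.BirchSwinnertonDyer.Theorems.AlignedTransportAtTwoCyclotomicLayerRankDichotomy
  Summit.BirchSwinnertonDyer.BirchSwinnertonDyer.Theorems.AlignedTransportAtTwoCyclotomicLayerLFunction
  Summit.BirchSwinnertonDyer.BirchSwinnertonDyer.Theorems.AlignedTransportAtTwoCyclotomicLayerRankJumpBound

universe u

/-! ## §1 The exact jump -/

section Exact

variable {K : Type u} [Field K] [NumberField K] (W : WeierstrassCurve K) [W.IsElliptic] {p : ℕ} [hp : Fact p.Prime]
  {κ : ZpExtension K p} {γ : Field.absoluteGaloisGroup K}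

/-- ★★★ **THE EXACT JUMP** (with the divisibility of `E(K̄)` as hypothesis `hdiv`, discharged below): for `E/K` elliptic over a number field, ANY `ℤ_p`-extension `κ` with
topological generator `γ`, a dual datum with `X` finitely generated and torsion, `f ∈ char_Λ X` and every `n`:
**`∃ c, Φ_{p^{n+1}}(1+T)^c ∣ f ∧ rank E(K_{n+1}) = rank E(K_n) + pⁿ(p−1)·c`.** (`c = rank_ℤ A_n / pⁿ(p−1)` for the kernel lattice `A_n` of the relative norm;
`rank E(K_{n+1}) = rank E(K_n) + rank A_n` because `ι_{n+1}(A_n) ∩ ι_n(E(K_n))` is `p`-torsion and `N_n(E(K_{n+1})) ⊆ ι_n(E(K_n))`.)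
[cite: GreenbergLNM1716, §5 p. 132 and Thm. 1.9 (p. 63)] [cite: Washington1997, §13.1] -/
theorem exists_cyclotomicLayer_pow_dvd_and_mordellWeilRank_eq_of (hdiv : W.zsmul_geomPoints_surjective)
    (hγ : κ.IsTopGenerator γ) (D : W.SelmerDualData κ γ) [Module.Finite (IwasawaAlgebra p) D.X]
    (hD : D.IsTorsion) {f : IwasawaAlgebra p} (hf : f ∈ D.charIdeal) (n : ℕ) :
    ∃ c : ℕ, (((cyclotomic (p ^ (n + 1)) ℤ_[p]).comp (X + 1) : ℤ_[p][X]) : PowerSeries ℤ_[p]) ^ c ∣ f ∧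
      (W.baseChange (κ.layer (n + 1))).mordellWeilRank = (W.baseChange (κ.layer n)).mordellWeilRank + p ^ n * (p - 1) * c := by
  letI : ∀ m, DecidableEq (κ.layer m) := fun m a b ↦ Classical.propDecidable (a = b)
  haveI : FiniteDimensional K (κ.layer (n + 1)) := κ.finiteDimensional_layer_holds (n + 1)
  haveI : NumberField (κ.layer (n + 1)) := NumberField.of_module_finite K (κ.layer (n + 1))
  haveI : FiniteDimensional K (κ.layer n) := κ.finiteDimensional_layer_holds n
  haveI : NumberField (κ.layer n) := NumberField.of_module_finite K (κ.layer n)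
  haveI := (W.baseChange (κ.layer (n + 1))).module_finite_point_holds
  haveI := (W.baseChange (κ.layer n)).module_finite_point_holds
  -- the relative norm and its kernel lattice
  let Nend : geomPoints W →+ geomPoints W :=
    { toFun := fun Q ↦ ∑ j ∈ Finset.range p, γ ^ (p ^ n * j) • Q
      map_zero' := by simp
      map_add' := fun Q Q' ↦ by simp [Finset.sum_add_distrib] }
  have hNend : ∀ Q, Nend Q = ∑ j ∈ Finset.range p, γ ^ (p ^ n * j) • Q := fun _ ↦ rfl
  let N := Nend.comp (layerPointsMap W κ (n + 1))
  have hN : ∀ P, N P = ∑ j ∈ Finset.range p, γ ^ (p ^ n * j) • layerPointsMap W κ (n + 1) P := fun _ ↦ rfl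
  set φ := N.toIntLinearMap with hφ
  let A := LinearMap.ker φ
  have hmemA : ∀ {P}, P ∈ A ↔ ∑ j ∈ Finset.range p, γ ^ (p ^ n * j) • layerPointsMap W κ (n + 1) P = 0 := fun {P} ↦ by
    rw [LinearMap.mem_ker]; exact Iff.rfl
  let g := (layerGal W κ (n + 1) γ).toIntLinearMap
  have hgA : ∀ P ∈ A, g P ∈ A := by
    intro P hP
    rw [hmemA] at hP ⊢
    change ∑ j ∈ Finset.range p, γ ^ (p ^ n * j) • layerPointsMap W κ (n + 1) (layerGal W κ (n + 1) γ P) = 0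
    simp_rw [layerPointsMap_layerGal, smul_smul, ← pow_succ, pow_succ', mul_smul, ← Finset.smul_sum, hP, smul_zero]
  let gA : Module.End ℤ A := g.restrict hgA
  have hpow : ∀ (k : ℕ) (a : A), ((gA ^ k) a : (W.baseChange (κ.layer (n + 1))).toAffine.Point) = (layerGal W κ (n + 1) γ)^[k] a := by
    intro k a
    induction k with
    | zero => rfl
    | succ k ih => rw [pow_succ', Module.End.mul_apply, Function.iterate_succ_apply', ← ih]; rfl
  have haeval : Polynomial.aeval gA (cyclotomic (p ^ (n + 1)) ℤ) = 0 := by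
    ext a
    rw [cyclotomic_prime_pow_eq_geom_sum hp.out, map_sum, LinearMap.coe_sum, Finset.sum_apply, LinearMap.zero_apply,
      Submodule.coe_zero, AddSubmonoidClass.coe_finsetSum]
    simp_rw [← pow_mul, map_pow, Polynomial.aeval_X, hpow, layerGal_iterate_apply, pow_mul, ← layerGal_iterate_apply]
    exact sum_layerGal_iterate_eq_zero_of_relNorm_eq_zero W κ γ n (hmemA.mp a.2)
  have hdvdA : p ^ n * (p - 1) ∣ Module.finrank ℤ A := by
    have h := totient_dvd_finrank_of_aeval_cyclotomic_eq_zero gA (pow_pos hp.out.pos (n + 1)) haeval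
    rwa [Nat.totient_prime_pow_succ hp.out] at h
  obtain ⟨c, hc⟩ := hdvdA
  -- rank–nullity: `rank E(K_{n+1}) = rank N(E(K_{n+1})) + rank A_n ≤ rank E(K_n) + rank A_n`
  have h1 := Submodule.finrank_quotient_add_finrank (LinearMap.ker φ)
  rw [φ.quotKerEquivRange.finrank_eq] at h1
  have hT_le : LinearMap.range φ ≤ LinearMap.range (layerPointsMap W κ n).toIntLinearMap := by
    rintro _ ⟨P, rfl⟩
    obtain ⟨Q, hQ⟩ := exists_layerPoints_eq_relNorm W κ n hγ P
    exact ⟨Q, hQ.trans (hN P).symm⟩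
  have hrkn : Module.finrank ℤ (LinearMap.range (layerPointsMap W κ n).toIntLinearMap) = (W.baseChange (κ.layer n)).mordellWeilRank := by
    unfold WeierstrassCurve.mordellWeilRank
    exact LinearMap.finrank_range_of_inj (layerPointsMap_injective W κ n)
  have hrkn1 : Module.finrank ℤ (LinearMap.range (layerPointsMap W κ (n + 1)).toIntLinearMap) =
      (W.baseChange (κ.layer (n + 1))).mordellWeilRank := by
    unfold WeierstrassCurve.mordellWeilRank
    exact LinearMap.finrank_range_of_inj (layerPointsMap_injective W κ (n + 1))
  have h2 : Module.finrank ℤ (LinearMap.range φ) ≤ (W.baseChange (κ.layer n)).mordellWeilRank :=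
    hrkn ▸ Submodule.finrank_mono hT_le
  -- the reverse inequality: `ι_{n+1}(A_n) + ι_n(E(K_n)) ⊆ ι_{n+1}(E(K_{n+1}))` with `p`-torsion intersection
  let S := Submodule.map (layerPointsMap W κ (n + 1)).toIntLinearMap A
  let T := LinearMap.range (layerPointsMap W κ n).toIntLinearMap
  have hST : S ⊔ T ≤ LinearMap.range (layerPointsMap W κ (n + 1)).toIntLinearMap := by
    refine sup_le ?_ ?_
    · rintro _ ⟨a, -, rfl⟩; exact ⟨a, rfl⟩
    · rintro _ ⟨Q, rfl⟩
      obtain ⟨P, hP⟩ := exists_layerPointsMap_eq W κ (n + 1) (layerPointsMap W κ n Q)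
        fun σ hσ ↦ smul_layerPointsMap W κ n Q σ (κ.layerSubgroup_antitone n.le_succ hσ)
      exact ⟨P, hP⟩
  have hinf : Module.rank ℤ (S ⊓ T : Submodule ℤ (geomPoints W)) = 0 := by
    rw [rank_eq_zero_iff]
    rintro ⟨x, hxS, hxT⟩
    obtain ⟨a, haA, hax⟩ := hxS
    obtain ⟨Q, hQx⟩ := hxT
    refine ⟨(p : ℤ), by exact_mod_cast hp.out.ne_zero, Subtype.ext ?_⟩
    change (p : ℤ) • x = 0
    -- `N_n(a) = p • x` since `γ^{pⁿ j}` fixes `ι_n(Q) = x`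
    have hfix : ∀ j : ℕ, γ ^ (p ^ n * j) • x = x := fun j ↦ by
      rw [← hQx, pow_mul]
      exact smul_layerPointsMap W κ n Q _ (Subgroup.pow_mem _ (ZpExtension.pow_mem_layerSubgroup κ hγ n) j)
    have hNa : N a = (p : ℤ) • x := by
      rw [hN, show layerPointsMap W κ (n + 1) a = x from hax]
      simp_rw [hfix]
      rw [Finset.sum_const, Finset.card_range, natCast_zsmul]
    rw [← hNa]
    exact (hmemA.mp (by simpa [A] using haA) : _)
  have hS : Module.finrank ℤ S = Module.finrank ℤ A :=
    (Submodule.equivMapOfInjective _ (layerPointsMap_injective W κ (n + 1)) A).finrank_eq.symm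
  have hsum : Module.finrank ℤ A + (W.baseChange (κ.layer n)).mordellWeilRank ≤ (W.baseChange (κ.layer (n + 1))).mordellWeilRank := by
    have key : Module.rank ℤ S + Module.rank ℤ T ≤ Module.rank ℤ (LinearMap.range (layerPointsMap W κ (n + 1)).toIntLinearMap) := by
      rw [← Submodule.rank_sup_add_rank_inf_eq, hinf, add_zero]
      exact Submodule.rank_mono hST
    rw [← Module.finrank_eq_rank, ← Module.finrank_eq_rank, ← Module.finrank_eq_rank, hS, hrkn, hrkn1] at key
    exact_mod_cast key
  refine ⟨c, ?_, ?_⟩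
  · obtain ⟨P, lam, N₀, hN₀, hPA, hlam⟩ := exists_points_functionals_of_le A
    exact cyclotomicLayer_pow_dvd_of_mem_charIdeal_of_points_functionals W hdiv hγ D hD hf n (le_of_eq hc.symm) P lam N₀ hN₀
      (fun i ↦ sum_layerGal_iterate_eq_zero_of_relNorm_eq_zero W κ γ n (hmemA.mp (hPA i))) hlam
  · unfold WeierstrassCurve.mordellWeilRank at h2 hsum ⊢
    change Module.finrank ℤ _ + Module.finrank ℤ A = Module.finrank ℤ _ at h1
    rw [← hc]
    omega

/-- ★★★ **THE EXACT JUMP, UNCONDITIONALLY**: `∃ c, Φ_{p^{n+1}}(1+T)^c ∣ f ∧ rank_ℤ E(K_{n+1}) = rank_ℤ E(K_n) + pⁿ(p−1)·c` — for every `f ∈ char_Λ X(E/K_∞)`, every layer `n`,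
every `ℤ_p`-extension of every number field (dual datum with `X` finitely generated and torsion). [cite: GreenbergLNM1716, §5 p. 132 and Thm. 1.9 (p. 63)] -/
theorem exists_cyclotomicLayer_pow_dvd_and_mordellWeilRank_eq (hγ : κ.IsTopGenerator γ) (D : W.SelmerDualData κ γ)
    [Module.Finite (IwasawaAlgebra p) D.X] (hD : D.IsTorsion) {f : IwasawaAlgebra p} (hf : f ∈ D.charIdeal) (n : ℕ) :
    ∃ c : ℕ, (((cyclotomic (p ^ (n + 1)) ℤ_[p]).comp (X + 1) : ℤ_[p][X]) : PowerSeries ℤ_[p]) ^ c ∣ f ∧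
      (W.baseChange (κ.layer (n + 1))).mordellWeilRank = (W.baseChange (κ.layer n)).mordellWeilRank + p ^ n * (p - 1) * c :=
  exists_cyclotomicLayer_pow_dvd_and_mordellWeilRank_eq_of W W.zsmul_geomPoints_surjective_holds hγ D hD hf n

/-- ★★ **`φ(p^{n+1}) = pⁿ(p−1)` DIVIDES THE JUMP `rank E(K_{n+1}) − rank E(K_n)`** in every `ℤ_p`-tower of every number field (granted a torsion finitely generated dual
datum of `Sel_{p^∞}(E/K_∞)` — e.g. over the cyclotomic tower of `ℚ` at a good ordinary prime, Kato): the integrality of `e_{n+1}` that `FineSelmerGcdProblems.lean`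
assumed. [cite: KuriharaPollack2007, §3.1] [cite: Washington1997, §13.1] -/
theorem totient_dvd_mordellWeilRank_layer_succ_sub (hγ : κ.IsTopGenerator γ) (D : W.SelmerDualData κ γ)
    [Module.Finite (IwasawaAlgebra p) D.X] (hD : D.IsTorsion) (n : ℕ) :
    p ^ n * (p - 1) ∣ (W.baseChange (κ.layer (n + 1))).mordellWeilRank - (W.baseChange (κ.layer n)).mordellWeilRank := by
  obtain ⟨c, -, hc⟩ := exists_cyclotomicLayer_pow_dvd_and_mordellWeilRank_eq W hγ D hD (Submodule.zero_mem D.charIdeal) n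
  exact ⟨c, by omega⟩

/-- ★★ **`Φ_{p^{n+1}}(1+T)^{e_{n+1}} ∣ f` with `e_{n+1} = (rank E(K_{n+1}) − rank E(K_n)) / (pⁿ(p−1))`** (exact division by the previous theorem): the Mordell–Weil multiplicity
of the layer is a lower bound for the multiplicity of the layer prime in `char_Λ X`. [cite: GreenbergLNM1716, §5 p. 132] [cite: KuriharaPollack2007, §3.1] -/
theorem cyclotomicLayer_pow_jump_div_dvd (hγ : κ.IsTopGenerator γ) (D : W.SelmerDualData κ γ)
    [Module.Finite (IwasawaAlgebra p) D.X] (hD : D.IsTorsion) {f : IwasawaAlgebra p} (hf : f ∈ D.charIdeal) (n : ℕ) :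
    (((cyclotomic (p ^ (n + 1)) ℤ_[p]).comp (X + 1) : ℤ_[p][X]) : PowerSeries ℤ_[p]) ^
        (((W.baseChange (κ.layer (n + 1))).mordellWeilRank - (W.baseChange (κ.layer n)).mordellWeilRank) / (p ^ n * (p - 1))) ∣ f := by
  obtain ⟨c, hdvd, hc⟩ := exists_cyclotomicLayer_pow_dvd_and_mordellWeilRank_eq W hγ D hD hf n
  have hpos : 0 < p ^ n * (p - 1) := Nat.mul_pos (pow_pos hp.out.pos n) (by have := hp.out.two_le; omega)
  have he : ((W.baseChange (κ.layer (n + 1))).mordellWeilRank - (W.baseChange (κ.layer n)).mordellWeilRank) / (p ^ n * (p - 1)) = c := by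
    rw [hc, Nat.add_sub_cancel_left, Nat.mul_div_cancel_left _ hpos]
  rw [he]; exact hdvd

/-- **Cyclotomic tower over a number field, no finiteness hypothesis.** [cite: GreenbergLNM1716, §5 p. 132 and §1 p. 60] -/
theorem exists_cyclotomicLayer_pow_dvd_and_mordellWeilRank_eq_of_isCyclotomic (hκ : κ.IsCyclotomic) (hγ : κ.IsTopGenerator γ)
    (D : W.SelmerDualData κ γ) (hD : D.IsTorsion) {f : IwasawaAlgebra p} (hf : f ∈ D.charIdeal) (n : ℕ) :
    ∃ c : ℕ, (((cyclotomic (p ^ (n + 1)) ℤ_[p]).comp (X + 1) : ℤ_[p][X]) : PowerSeries ℤ_[p]) ^ c ∣ f ∧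
      (W.baseChange (κ.layer (n + 1))).mordellWeilRank = (W.baseChange (κ.layer n)).mordellWeilRank + p ^ n * (p - 1) * c := by
  haveI : Module.Finite (IwasawaAlgebra p) D.X := D.module_finite_of_isCyclotomic W κ hκ hγ
  exact exists_cyclotomicLayer_pow_dvd_and_mordellWeilRank_eq W hγ D hD hf n

end Exact

/-! ## §2 Over `ℚ` (Kato): `Φ_{p^{n+1}}(1+T)^{e_{n+1}} ∣ L_p` -/

section Analytic

open PowerSeries CongruenceSubgroup Literature.NumberTheory.EllipticCurves.ModularForms
  Literature.NumberTheory.EllipticCurves.Rank1Residual Literature.NumberTheory.EllipticCurves.Greenberg1999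
  Summit.BirchSwinnertonDyer.Rank1Residual

variable (W : WeierstrassCurve ℚ) [W.IsElliptic] [W.IsGloballyMinimal] {p : ℕ} [hp : Fact p.Prime]

/-- ★★ **`∃ c, Φ_{p^{n+1}}(1+T)^c ∣ G ∧ rank W(ℚ_{n+1}) = rank W(ℚ_n) + pⁿ(p−1)·c`** for every integral lift `G` of `L_p(f,α)` (`W/ℚ` good ordinary at `p`, PRINT `h17`, cyclotomic
`κ` with normalised generator): the jump is EXACTLY `φ(p^{n+1})·c` and `L_p` vanishes to order `≥ c` at every character of order `p^{n+1}`.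
[cite: Kato2004Asterisque, Thm. 17.4 (1)(2) (p. 273) and Thm. 18.4 (p. 281)] [cite: GreenbergLNM1716, §5 p. 132] -/
theorem exists_cyclotomicLayer_pow_dvd_lift_and_mordellWeilRank_eq {N : ℕ} [NeZero N] {f : CuspForm (Gamma0 N) 2}
    (h17 : kato_divisibility_allPrimes W p (f := f)) (hord : IsOrdinaryAt W p) (hf : IsNewformOf W f)
    {G : IwasawaAlgebra p} (hG : iwasawaToPowerSeries p G = padicLFunction f (unitRoot W p : ℚ_[p]))
    {κ : ZpExtension ℚ p} {γ : Field.absoluteGaloisGroup ℚ} (hκ : κ.IsCyclotomic) (hγ : κ.IsTopGenerator γ)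
    (hγ' : IsCyclotomicVariable p γ) (n : ℕ) :
    ∃ c : ℕ, (((cyclotomic (p ^ (n + 1)) ℤ_[p]).comp (Polynomial.X + 1) : ℤ_[p][X]) : PowerSeries ℤ_[p]) ^ c ∣ G ∧
      (W.baseChange (κ.layer (n + 1))).mordellWeilRank = (W.baseChange (κ.layer n)).mordellWeilRank + p ^ n * (p - 1) * c := by
  obtain ⟨D⟩ := W.nonempty_selmerDualData_holds κ γ hγ
  haveI : Module.Finite (IwasawaAlgebra p) D.X := D.module_finite_holds hγ
  haveI : (Module.charIdeal (IwasawaAlgebra p) D.X).IsPrincipal := charIdeal_isPrincipal_holds p D.X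
  obtain ⟨fX, hfX⟩ := Submodule.IsPrincipal.principal (Module.charIdeal (IwasawaAlgebra p) D.X)
  have hchar : D.charIdeal = Ideal.span {fX} := hfX
  obtain ⟨hD, a, m, hrel⟩ := isTorsion_and_exists_charGen_mul_eq_C_pow_mul_of_kato W h17 hκ hγ hγ' hord hf D hchar hG
  obtain ⟨c, hdvd, hc⟩ := exists_cyclotomicLayer_pow_dvd_and_mordellWeilRank_eq W hγ D hD (hchar ▸ Ideal.mem_span_singleton_self fX) n
  exact ⟨c, cyclotomicLayer_pow_dvd_of_dvd_C_mul n c m (G := G) (by rw [← hrel]; exact dvd_mul_of_dvd_left hdvd a), hc⟩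

/-- ★★ **`Φ_{p^{n+1}}(1+T)^{e_{n+1}} ∣ L_p` with `e_{n+1} = (rank W(ℚ_{n+1}) − rank W(ℚ_n))/φ(p^{n+1})` an INTEGER dividing exactly**: the order of vanishing of the
`p`-adic `L`-function at the characters of order `p^{n+1}` is at least the Mordell–Weil multiplicity of the layer (Kato's «`rank ≤ ord_{s=1} L_p`» resolved layer by layer).
[cite: Kato2004Asterisque, Thm. 17.4 (1)(2) (p. 273) and Thm. 18.4 (p. 281)] [cite: KuriharaPollack2007, §3.1] -/
theorem cyclotomicLayer_pow_jump_div_dvd_lift {N : ℕ} [NeZero N] {f : CuspForm (Gamma0 N) 2}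
    (h17 : kato_divisibility_allPrimes W p (f := f)) (hord : IsOrdinaryAt W p) (hf : IsNewformOf W f)
    {G : IwasawaAlgebra p} (hG : iwasawaToPowerSeries p G = padicLFunction f (unitRoot W p : ℚ_[p]))
    {κ : ZpExtension ℚ p} {γ : Field.absoluteGaloisGroup ℚ} (hκ : κ.IsCyclotomic) (hγ : κ.IsTopGenerator γ)
    (hγ' : IsCyclotomicVariable p γ) (n : ℕ) :
    p ^ n * (p - 1) ∣ (W.baseChange (κ.layer (n + 1))).mordellWeilRank - (W.baseChange (κ.layer n)).mordellWeilRank ∧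
    (((cyclotomic (p ^ (n + 1)) ℤ_[p]).comp (Polynomial.X + 1) : ℤ_[p][X]) : PowerSeries ℤ_[p]) ^
        (((W.baseChange (κ.layer (n + 1))).mordellWeilRank - (W.baseChange (κ.layer n)).mordellWeilRank) / (p ^ n * (p - 1))) ∣ G := by
  obtain ⟨c, hdvd, hc⟩ := exists_cyclotomicLayer_pow_dvd_lift_and_mordellWeilRank_eq W h17 hord hf hG hκ hγ hγ' n
  have hpos : 0 < p ^ n * (p - 1) := Nat.mul_pos (pow_pos hp.out.pos n) (by have := hp.out.two_le; omega)
  have hsub : (W.baseChange (κ.layer (n + 1))).mordellWeilRank - (W.baseChange (κ.layer n)).mordellWeilRank = p ^ n * (p - 1) * c := by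
    rw [hc, Nat.add_sub_cancel_left]
  refine ⟨⟨c, hsub⟩, ?_⟩
  rw [hsub, Nat.mul_div_cancel_left _ hpos]
  exact hdvd

end Analytic

end Summit.BirchSwinnertonDyer.BirchSwinnertonDyer.Theorems.AlignedTransportAtTwoCyclotomicLayerRankJumpExact
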